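import Mathlib
import Literature.MathematicalPhysics.StatisticalMechanics.Crystallization
import Literature.MathematicalPhysics.StatisticalMechanics.LennardJonesClusters
import Literature.MathematicalPhysics.StatisticalMechanics.StickyChain
import Literature.Algebra.EuclideanLattices.IntegerBases
import Summits.AtomisticToContinuum.Crystallization.Theorems.ThreeConeCertificateExactCertificateTransfer1D

/-!
# `ExactCertificate` (stmt-AtomisticToContinuum-11959), line `closure-makes-nogap-exact`,
# Transfer skeleton II (`Cruxes.ExactCertificate.Transfer1D.Crystallization1D`): the lead's budget stubs

Support file for the crux `ThreeConeCertificate.ExactCertificate` (crux 11959), line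
`closure-makes-nogap-exact`, TRANSFER skeleton II — the POSITIONAL crystallization of the Lennard-Jones
chain, `IsCrystallizing lennardJones 1`, hence the whole sub-problem statement with `3 ↦ 1`.
Nothing here closes an item.  This file proves the four lead-held bookkeeping stubs of that skeleton:

* `stub_aBounds` — the zero-pressure lattice constant `a` (`Σ_{m≥1} m V′(ma) = 0`, i.e.
  `a⁶ = ζ(12)/ζ(6)`) lies in the convexity box: `3/4 ≤ a ≤ 1`;
* `stub_keplerExplicit` — the SHARP KEPLER BOUND of the d = 1 certificate with `a` kept explicit:
  `N · Σ_{m≥1} V(ma) ≤ E_N(x)` for every configuration `x` of `N` distinct points of `ℝ¹`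
  (re-assembly of c6's `keplerBound1D` from the landed stubs `stub_tailFzero`, `stub_coreOf`,
  `stub_crossing`, `stub_posTypeOfPsi`, `stub_psiPosTypeOf`, `stub_quadAntitone`);
* `stub_chainBudget` — the finite chain's surface energy is bounded:
  `Σ_{d<N} (N − d) V(da) ≤ N · Σ_{m≥1} V(ma) + C_a` with `C_a = 2 Σ_d d |V(da)|`;
* `stub_chainPoints` — the chain `aℤ` as a `PeriodicConfiguration 1` whose point set is enumerated by
  `ℤ`, `k ↦ (k a) e₀`.

Together: a ground state of `N` Lennard-Jones particles on a line has energy within `C_a` of the perfect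
`N`-chain — the O(1) slack that the convexity step of the skeleton converts into `Σ_i (gap_i − a)² = O(1)`.
All `[folklore]`.
-/

noncomputable section

namespace Summit.AtomisticToContinuum.Crystallization.Theorems.ThreeConeCertificateExactCertificate.Transfer1D

open Literature.MathematicalPhysics.StatisticalMechanics
open Literature.Algebra.EuclideanLattices StickyChain
open scoped BigOperators

/-! ## The lattice constant lies in the box `[3/4, 1]` -/

/-- **Registered stub `stub_aBounds`.**  If `a > 0` is at zero pressure,
`Σ_{k≥0} (k+1)·[((k+1)a)⁻⁷ − ((k+1)a)⁻¹³] = 0`, then `a⁶ · ζ(6) = ζ(12)`, whence `a ≤ 1`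
(`ζ(12) ≤ ζ(6)`) and `a ≥ 3/4` (`ζ(12) ≥ 1`, `ζ(6) ≤ ζ(2) = π²/6 ≤ 8/3`, `(3/4)⁶·8/3 < 1`). [folklore] -/
theorem stub_aBounds : ∀ a : ℝ, 0 < a →
    HasSum (fun k : ℕ => ((k : ℝ) + 1) * ((((k : ℝ) + 1) * a)⁻¹ ^ 7 - (((k : ℝ) + 1) * a)⁻¹ ^ 13)) 0 →
    3 / 4 ≤ a ∧ a ≤ 1 := by
  intro a ha hz
  have hane : a ≠ 0 := ha.ne'
  -- the two zeta values as sums over `k + 1`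
  have hs6 : Summable (fun k : ℕ => ((k : ℝ) + 1)⁻¹ ^ 6) := by
    have h' := (summable_nat_add_iff 1).2 (Real.summable_nat_pow_inv.2 (by norm_num : 1 < 6))
    refine h'.congr fun k => ?_
    push_cast
    rw [inv_pow]
  have hs12 : Summable (fun k : ℕ => ((k : ℝ) + 1)⁻¹ ^ 12) := by
    have h' := (summable_nat_add_iff 1).2 (Real.summable_nat_pow_inv.2 (by norm_num : 1 < 12))
    refine h'.congr fun k => ?_
    push_cast
    rw [inv_pow]
  set Z6 : ℝ := ∑' k : ℕ, ((k : ℝ) + 1)⁻¹ ^ 6 with hZ6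
  set Z12 : ℝ := ∑' k : ℕ, ((k : ℝ) + 1)⁻¹ ^ 12 with hZ12
  have hZ6pos : 0 < Z6 :=
    lt_of_lt_of_le (by norm_num : (0 : ℝ) < ((((0 : ℕ) : ℝ) + 1)⁻¹ ^ 6))
      (le_hasSum hs6.hasSum 0 fun k _ => by positivity)
  have hZ12one : 1 ≤ Z12 := by
    have h := le_hasSum hs12.hasSum 0 fun k _ => by positivity
    have h0 : (((0 : ℕ) : ℝ) + 1)⁻¹ ^ 12 = 1 := by norm_num
    rw [h0] at h
    exact h
  have hZ12le : Z12 ≤ Z6 := by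
    refine hs12.tsum_le_tsum (fun k => ?_) hs6
    have hk1 : ((k : ℝ) + 1)⁻¹ ≤ 1 := inv_le_one_of_one_le₀ (by linarith [(k.cast_nonneg : (0 : ℝ) ≤ k)])
    exact pow_le_pow_of_le_one (by positivity) hk1 (by norm_num)
  -- the zero-pressure identity `a⁻⁷ Z6 − a⁻¹³ Z12 = 0`
  have hterm : ∀ k : ℕ, ((k : ℝ) + 1) * ((((k : ℝ) + 1) * a)⁻¹ ^ 7 - (((k : ℝ) + 1) * a)⁻¹ ^ 13)
      = a⁻¹ ^ 7 * ((k : ℝ) + 1)⁻¹ ^ 6 - a⁻¹ ^ 13 * ((k : ℝ) + 1)⁻¹ ^ 12 := by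
    intro k
    have hk : (k : ℝ) + 1 ≠ 0 := by positivity
    rw [mul_inv, mul_pow, mul_pow]
    field_simp
  have hsum : HasSum (fun k : ℕ => a⁻¹ ^ 7 * ((k : ℝ) + 1)⁻¹ ^ 6 - a⁻¹ ^ 13 * ((k : ℝ) + 1)⁻¹ ^ 12)
      (a⁻¹ ^ 7 * Z6 - a⁻¹ ^ 13 * Z12) :=
    (hs6.hasSum.mul_left _).sub (hs12.hasSum.mul_left _)
  have hz' : HasSum (fun k : ℕ => a⁻¹ ^ 7 * ((k : ℝ) + 1)⁻¹ ^ 6 - a⁻¹ ^ 13 * ((k : ℝ) + 1)⁻¹ ^ 12) 0 := by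
    have hfun : (fun k : ℕ => ((k : ℝ) + 1) * ((((k : ℝ) + 1) * a)⁻¹ ^ 7 - (((k : ℝ) + 1) * a)⁻¹ ^ 13))
        = fun k : ℕ => a⁻¹ ^ 7 * ((k : ℝ) + 1)⁻¹ ^ 6 - a⁻¹ ^ 13 * ((k : ℝ) + 1)⁻¹ ^ 12 :=
      funext hterm
    rw [← hfun]
    exact hz
  have heq : a⁻¹ ^ 7 * Z6 - a⁻¹ ^ 13 * Z12 = 0 := hsum.unique hz'
  -- hence `a⁶ Z6 = Z12`
  have hkey : a ^ 6 * Z6 = Z12 := by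
    have h1 : a⁻¹ ^ 7 * Z6 = a⁻¹ ^ 13 * Z12 := by linarith
    have h2 : a ^ 13 * (a⁻¹ ^ 7 * Z6) = a ^ 13 * (a⁻¹ ^ 13 * Z12) := by rw [h1]
    have h3 : a ^ 13 * (a⁻¹ ^ 7 * Z6) = a ^ 6 * Z6 := by
      rw [inv_pow, ← mul_assoc, show a ^ 13 = a ^ 6 * a ^ 7 by ring, mul_assoc (a ^ 6),
        mul_inv_cancel₀ (pow_ne_zero 7 hane), mul_one]
    have h4 : a ^ 13 * (a⁻¹ ^ 13 * Z12) = Z12 := by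
      rw [inv_pow, ← mul_assoc, mul_inv_cancel₀ (pow_ne_zero 13 hane), one_mul]
    rw [← h3, h2, h4]
  constructor
  · -- `a ≥ 3/4`: otherwise `Z12 = a⁶ Z6 < (3/4)⁶ · (8/3) < 1`
    by_contra hlt
    rw [not_le] at hlt
    -- `Z6 ≤ ζ(2) = π²/6 ≤ 8/3`
    have hs2 : HasSum (fun k : ℕ => 1 / (((k + 1 : ℕ) : ℝ)) ^ 2) (Real.pi ^ 2 / 6) := by
      have h := (hasSum_nat_add_iff' 1).2 hasSum_zeta_two
      simpa using h
    have hZ6le : Z6 ≤ Real.pi ^ 2 / 6 := by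
      refine hasSum_le (fun k => ?_) hs6.hasSum hs2
      have hk0 : (0 : ℝ) < (k : ℝ) + 1 := by positivity
      have hk1 : ((k : ℝ) + 1)⁻¹ ≤ 1 := inv_le_one_of_one_le₀ (by linarith [(k.cast_nonneg : (0 : ℝ) ≤ k)])
      calc ((k : ℝ) + 1)⁻¹ ^ 6 ≤ ((k : ℝ) + 1)⁻¹ ^ 2 :=
            pow_le_pow_of_le_one (by positivity) hk1 (by norm_num)
        _ = 1 / (((k + 1 : ℕ) : ℝ)) ^ 2 := by push_cast; rw [inv_pow, one_div]
    have hpi : Real.pi ^ 2 / 6 ≤ 8 / 3 := by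
      have h4 := Real.pi_le_four
      have h0 := Real.pi_pos.le
      nlinarith
    have ha6 : a ^ 6 < (3 / 4 : ℝ) ^ 6 := pow_lt_pow_left₀ hlt ha.le (by norm_num)
    have : Z12 < 1 := by
      rw [← hkey]
      calc a ^ 6 * Z6 ≤ a ^ 6 * (8 / 3) := mul_le_mul_of_nonneg_left (hZ6le.trans hpi) (by positivity)
        _ < (3 / 4 : ℝ) ^ 6 * (8 / 3) := mul_lt_mul_of_pos_right ha6 (by norm_num)
        _ < 1 := by norm_num
    linarith
  · -- `a ≤ 1`: `a⁶ Z6 = Z12 ≤ Z6`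
    have h6 : a ^ 6 ≤ 1 := by
      by_contra hlt
      rw [not_le] at hlt
      have : Z6 < a ^ 6 * Z6 := by nlinarith
      linarith
    exact (pow_le_one_iff_of_nonneg ha.le (by norm_num)).1 h6

/-! ## The sharp Kepler bound at an explicit lattice constant -/

/-- **Registered stub `stub_keplerExplicit`** (the d = 1 certificate of c6 with `a` explicit): if `a > 0` is at
zero pressure then `N · Σ_{m≥1} V(ma) ≤ E_N(x)` for every configuration `x` of `N` distinct points of the
line — `E_V(x) ≥ E_{F_a}(x) ≥ −N·F_a(0)/2 = N·Σ_{m≥1}V(ma)` (tail interpolant `F_a ≤ V`, of positive type,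
`F_a(0) = −2Σ_{m≥1}V(ma)`). [folklore] -/
theorem stub_keplerExplicit : ∀ a : ℝ, 0 < a →
    HasSum (fun k : ℕ => ((k : ℝ) + 1) * ((((k : ℝ) + 1) * a)⁻¹ ^ 7 - (((k : ℝ) + 1) * a)⁻¹ ^ 13)) 0 →
    ∀ (N : ℕ) (x : Fin N → EuclideanSpace ℝ (Fin 1)), Function.Injective x →
      (N : ℝ) * ∑' k : ℕ, lennardJones (((k : ℝ) + 1) * a) ≤ interactionEnergy lennardJones x := by
  intro a ha hz N x hx
  obtain ⟨htail, hF0⟩ := stub_tailFzero a ha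
  -- the tail interpolant `F_a`
  set Fa : ℝ → ℝ := fun x => ∑' k : ℕ, ((k : ℝ) + 1) * (lennardJones (|x + a| + ((k : ℝ) + 1) * a)
      - 2 * lennardJones (|x| + ((k : ℝ) + 1) * a) + lennardJones (|x - a| + ((k : ℝ) + 1) * a)) with hFa
  have hFa_tail : ∀ x : ℝ, a ≤ x → Fa x = lennardJones x := fun x hx => htail x hx
  have hFa_zero : Fa 0 = -2 * ∑' k : ℕ, lennardJones (((k : ℝ) + 1) * a) := by
    rw [← hF0, hFa]
    simp only [zero_add, zero_sub, abs_neg, abs_zero, abs_of_pos ha]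
  have hcore : ∀ r : ℝ, 0 < r → r < a → Fa r ≤ lennardJones r :=
    fun r hr hra => stub_coreOf stub_crossing a ha hz r hr hra
  have hpos : ∀ (n : ℕ) (y : Fin n → EuclideanSpace ℝ (Fin 1)) (w : Fin n → ℝ),
      0 ≤ ∑ i, ∑ j, w i * w j * Fa (dist (y i) (y j)) :=
    stub_posTypeOfPsi a ha (stub_psiPosTypeOf stub_quadAntitone stub_crossing a ha hz)
  have hle : ∀ r : ℝ, 0 < r → Fa r ≤ lennardJones r := fun r hr => by
    by_cases h : r < a
    · exact hcore r hr h
    · exact (hFa_tail r (not_lt.1 h)).le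
  -- `−N F(0)/2 ≤ E_F(x) ≤ E_V(x)`
  have hFE : -((N : ℝ) * Fa 0 / 2) ≤ interactionEnergy Fa x := by
    have h1 := hpos N x (fun _ => 1)
    simp only [one_mul] at h1
    have h2 : ∑ i, ∑ j, Fa (dist (x i) (x j)) = N * Fa 0 + 2 * interactionEnergy Fa x := by
      rw [two_mul_interactionEnergy]
      have h : ∀ i : Fin N, ∑ j, Fa (dist (x i) (x j)) = Fa 0 + siteEnergy Fa x i := fun i => by
        rw [siteEnergy, ← Finset.add_sum_erase Finset.univ _ (Finset.mem_univ i), dist_self]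
      simp only [h, Finset.sum_add_distrib, Finset.sum_const, Finset.card_univ, Fintype.card_fin,
        nsmul_eq_mul]
    rw [h2] at h1
    linarith
  have hVF : interactionEnergy Fa x ≤ interactionEnergy lennardJones x := by
    unfold interactionEnergy
    refine Finset.sum_le_sum fun i _ => Finset.sum_le_sum fun j hj => hle _ ?_
    exact dist_pos.2 fun heq => (Finset.mem_Ioi.1 hj).ne' (hx heq.symm)
  rw [hFa_zero] at hFE
  linarith

/-! ## The finite chain's surface energy is bounded -/

/-- **Registered stub `stub_chainBudget`.**  For `a > 0` there is `C` (namely `2Σ_d d|V(da)|`) with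
`Σ_{d<N} (N − d)·V(da) ≤ N·Σ_{m≥1}V(ma) + C` for every `N`: indeed
`Σ_{d<N}(N−d)V(da) − N Σ_{m≥1}V(ma) = −N Σ_{d≥N} V(da) − Σ_{d<N} d V(da)` and both terms are bounded by
`Σ_d d|V(da)| < ∞`. [folklore] -/
theorem stub_chainBudget : ∀ a : ℝ, 0 < a → ∃ C : ℝ, ∀ N : ℕ,
    ∑ d ∈ Finset.range N, ((N : ℝ) - d) * lennardJones (d * a) ≤
      N * ∑' k : ℕ, lennardJones (((k : ℝ) + 1) * a) + C := by
  intro a ha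
  set φ : ℕ → ℝ := fun d => lennardJones (d * a) with hφ
  have hφ0 : φ 0 = 0 := by simp [hφ, lennardJones_zero]
  have hφs : ∀ k : ℕ, φ (k + 1) = lennardJones (((k : ℝ) + 1) * a) := fun k => by
    simp only [hφ]; push_cast; rfl
  -- the weight `g d = d |V(da)|`, summable
  set g : ℕ → ℝ := fun d => (d : ℝ) * |φ d| with hg
  have hg0 : ∀ d, 0 ≤ g d := fun d => by positivity
  have hgs : Summable g := by
    have h1 : Summable (fun k : ℕ => ((k : ℝ) + 1) * lennardJones (((k : ℝ) + 1) * a)) := by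
      have h := tailFzero_summable_mul_lennardJones ha le_rfl
      simpa only [zero_add] using h
    have h2 : Summable (fun k : ℕ => g (k + 1)) := by
      refine h1.abs.congr fun k => ?_
      show |((k : ℝ) + 1) * lennardJones (((k : ℝ) + 1) * a)| = ((k + 1 : ℕ) : ℝ) * |φ (k + 1)|
      rw [hφs, abs_mul, abs_of_pos (by positivity : (0 : ℝ) < (k : ℝ) + 1)]
      push_cast
      rfl
    exact (summable_nat_add_iff 1).1 h2
  have hφsum : Summable φ := by
    have h := tailFzero_summable_lennardJones ha
    exact (summable_nat_add_iff 1).1 (h.congr fun k => (hφs k).symm)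
  set A : ℝ := ∑' d : ℕ, g d with hA
  refine ⟨A + A, fun N => ?_⟩
  -- `Σ' m≥1 V(ma) = Σ_{d<N} φ d + Σ' d, φ (d + N)`
  have he : ∑' k : ℕ, lennardJones (((k : ℝ) + 1) * a) = ∑' d : ℕ, φ d := by
    rw [hφsum.tsum_eq_zero_add, hφ0, zero_add]
    exact tsum_congr fun k => (hφs k).symm
  have hsplit : ∑' d : ℕ, φ d = ∑ d ∈ Finset.range N, φ d + ∑' d : ℕ, φ (d + N) :=
    (hφsum.sum_add_tsum_nat_add N).symm
  -- bound 1: `−Σ_{d<N} d φ d ≤ A`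
  have hb1 : -∑ d ∈ Finset.range N, (d : ℝ) * φ d ≤ A := by
    calc -∑ d ∈ Finset.range N, (d : ℝ) * φ d ≤ ∑ d ∈ Finset.range N, g d := by
          rw [← Finset.sum_neg_distrib]
          refine Finset.sum_le_sum fun d _ => ?_
          rw [hg, ← mul_neg]
          exact mul_le_mul_of_nonneg_left (neg_le_abs _) (Nat.cast_nonneg d)
      _ ≤ A := hgs.sum_le_tsum (Finset.range N) fun d _ => hg0 d
  -- bound 2: `−N Σ' d, φ (d+N) ≤ A`
  have hb2 : -((N : ℝ) * ∑' d : ℕ, φ (d + N)) ≤ A := by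
    have hsN : Summable (fun d : ℕ => φ (d + N)) := (summable_nat_add_iff N).2 hφsum
    have hgN : Summable (fun d : ℕ => g (d + N)) := (summable_nat_add_iff N).2 hgs
    have h1 : -((N : ℝ) * ∑' d : ℕ, φ (d + N)) = ∑' d : ℕ, -((N : ℝ) * φ (d + N)) := by
      rw [← tsum_mul_left, ← tsum_neg]
    rw [h1]
    calc ∑' d : ℕ, -((N : ℝ) * φ (d + N)) ≤ ∑' d : ℕ, g (d + N) := by
          refine ((hsN.mul_left _).neg).tsum_le_tsum (fun d => ?_) hgN
          show -((N : ℝ) * φ (d + N)) ≤ ((d + N : ℕ) : ℝ) * |φ (d + N)|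
          rw [← mul_neg]
          push_cast
          calc (N : ℝ) * -φ (d + N) ≤ (N : ℝ) * |φ (d + N)| :=
                mul_le_mul_of_nonneg_left (neg_le_abs _) (Nat.cast_nonneg N)
            _ ≤ ((d : ℝ) + N) * |φ (d + N)| :=
                mul_le_mul_of_nonneg_right (by linarith [(d.cast_nonneg : (0 : ℝ) ≤ d)]) (abs_nonneg _)
      _ ≤ A := by
          rw [hA, ← hgs.sum_add_tsum_nat_add N]
          linarith [Finset.sum_nonneg fun d (_ : d ∈ Finset.range N) => hg0 d]
  -- assemble
  have hL : ∑ d ∈ Finset.range N, ((N : ℝ) - d) * lennardJones (d * a) =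
      (N : ℝ) * ∑ d ∈ Finset.range N, φ d - ∑ d ∈ Finset.range N, (d : ℝ) * φ d := by
    rw [Finset.mul_sum, ← Finset.sum_sub_distrib]
    refine Finset.sum_congr rfl fun d _ => ?_
    rw [hφ]
    ring
  rw [hL, he, hsplit, mul_add]
  linarith

/-! ## The chain `aℤ` with its point set enumerated by `ℤ` -/

/-- **Registered stub `stub_chainPoints`.**  For `a > 0` the chain `aℤ ⊂ ℝ¹` is a periodic configuration
(lattice of periods `aℤ¹`, motif `{0}`) whose point set is `{(k a) e₀ : k ∈ ℤ}`, enumerated bijectively by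
`ℤ`. [folklore] -/
theorem stub_chainPoints : ∀ a : ℝ, 0 < a → ∃ (P : PeriodicConfiguration 1) (e : ℤ ≃ P.points),
    ∀ k : ℤ, ((e k : P.points) : EuclideanSpace ℝ (Fin 1)) = EuclideanSpace.single (0 : Fin 1) ((k : ℝ) * a) := by
  intro a ha
  have ha0 : a ≠ 0 := ha.ne'
  -- the continuous linear equivalence `x ↦ a⁻¹ • x`, along which `ℤ¹` is pulled back to `aℤ¹`
  let L : EuclideanSpace ℝ (Fin 1) ≃L[ℝ] EuclideanSpace ℝ (Fin 1) :=
    (LinearEquiv.smulOfNeZero ℝ (EuclideanSpace ℝ (Fin 1)) a⁻¹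
      (inv_ne_zero ha0)).toContinuousLinearEquiv
  -- the chain `aℤ`: lattice of periods `aℤ¹`, motif `{0}`
  let Q : PeriodicConfiguration 1 :=
    { lattice := ZLattice.comap ℝ (stdIntLattice 1) L.toLinearMap
      discrete := inferInstance
      isZLattice := inferInstance
      motif := {0}
      motif_nonempty := ⟨0, Finset.mem_singleton_self 0⟩
      eq_of_sub_mem := fun x hx y hy _ => by
        rw [Finset.mem_singleton.1 hx, Finset.mem_singleton.1 hy] }
  -- membership in the lattice of periods: `g ∈ aℤ¹ ↔ g₀ ∈ aℤ`
  have hlat : ∀ g : EuclideanSpace ℝ (Fin 1), g ∈ Q.lattice ↔ ∃ k : ℤ, (k : ℝ) * a = g 0 := by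
    intro g
    have h1 : g ∈ Q.lattice ↔ a⁻¹ • g ∈ stdIntLattice 1 := by
      show g ∈ ZLattice.comap ℝ (stdIntLattice 1) _ ↔ _
      rw [ZLattice.comap, Submodule.mem_comap]
      rfl
    rw [h1, mem_stdIntLattice_iff]
    constructor
    · intro h
      obtain ⟨k, hk⟩ := h 0
      rw [PiLp.smul_apply, smul_eq_mul] at hk
      exact ⟨k, by rw [hk]; field_simp⟩
    · rintro ⟨k, hk⟩ j
      obtain rfl : j = 0 := Fin.fin_one_eq_zero j
      refine ⟨k, ?_⟩
      rw [PiLp.smul_apply, smul_eq_mul, ← hk]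
      field_simp
  -- membership in the point set (motif `{0}`: the points are the periods)
  have hpts : ∀ z : EuclideanSpace ℝ (Fin 1), z ∈ Q.points ↔ ∃ k : ℤ, (k : ℝ) * a = z 0 := by
    intro z
    constructor
    · rintro ⟨y, hy, g, hg, rfl⟩
      have hy0 : y = 0 := Finset.mem_singleton.1 hy
      obtain ⟨k, hk⟩ := (hlat g).1 hg
      exact ⟨k, by rw [hy0, zero_add, hk]⟩
    · rintro ⟨k, hk⟩
      exact ⟨0, Finset.mem_singleton_self 0, z, (hlat z).2 ⟨k, hk⟩, (zero_add z).symm⟩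
  -- the enumeration `k ↦ (k a) e₀`
  have hmem : ∀ k : ℤ, (EuclideanSpace.single 0 ((k : ℝ) * a) : EuclideanSpace ℝ (Fin 1)) ∈ Q.points :=
    fun k => (hpts _).2 ⟨k, by simp⟩
  let ε : ℤ → Q.points := fun k => ⟨EuclideanSpace.single 0 ((k : ℝ) * a), hmem k⟩
  have hε : Function.Bijective ε := by
    constructor
    · intro k k' h
      have h1 : (k : ℝ) * a = (k' : ℝ) * a := by
        have := congrArg (fun y : Q.points => (y : EuclideanSpace ℝ (Fin 1)) 0) h
        simpa [ε] using this
      exact_mod_cast mul_right_cancel₀ ha0 h1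
    · intro y
      obtain ⟨k, hk⟩ := (hpts y.1).1 y.2
      refine ⟨k, Subtype.ext (ext_zero ?_)⟩
      simpa [ε] using hk
  refine ⟨Q, Equiv.ofBijective ε hε, fun k => ?_⟩
  rfl

end Summit.AtomisticToContinuum.Crystallization.Theorems.ThreeConeCertificateExactCertificate.Transfer1D

end
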